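/-
Copyright (c) 2026 the pub-hodgecm-mathlib formalisation cell (harness21).  Prover seat hodgecm-mathlib-K2E4-p14 (g8), Track B ∕ K2-LIT (build stream 29), h413 =
`stmt-HodgeConjecture-24833`, campaign «EIS-R7-BL-SPH-3» (EXPORTS₃); dealer K2E1-plan (g6) rulings (94)∕(98)∕(101): BRICK 2 of the rank-3 print of the EXPORTS file — the inputs of
(E3)₃ «the continued constant-term coefficient»: the EXPLICIT Godement value of the `α₂`-coefficient (★ S2₃ with ★ (Ξ₂)₃'s explicit `b = φ₀·c(z)`) and the generic meromorphy device.
-/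
import Summits.HodgeConjecture.HodgeConjecture.Theorems.K2E1SphericalEisensteinSolvesXSystemU3        -- ★ p859104 (K2E1-p09): S2₃ and its mechanism (`eisensteinSeriesU_flatSectionU_quotientSubgroup_mul_three`, `continuous_borelHeight_cpow_three`; brings ★ `iota_toHX_eq_toHN`, `memLp_zFun_of_iotaBound`, ★ P2b′)
import Summits.HodgeConjecture.HodgeConjecture.Theorems.K2E1SphericalEisensteinContinuationU3Final     -- ★ (K2E4-p14 g6): (Ξ₂)₃ EXPLICIT `borelConstantTerm_sphericalEisenstein_cm_three` (`E_B(z,g) = φ₀·(H^z + c(z)·H^{2−z})`, `c(z) = ν(𝓕)⁻¹·∫ H(w₀v)^z dν`)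
import Literature.NumberTheory.Automorphic.ResolventKernels                                      -- ★ `ContinuousLinearMap.comp_meromorphicAt`
import HarnessLib

/-!
# «CLOSER₃ EXPORTS», BRICK 2 — `K2E1SphericalEisensteinConstantTermCoefficientCMThree`: the inputs of (E3)₃ (the continued constant-term coefficient of `U(2,1)_{L∕L⁺}`)

Track B ∕ K2-LIT, crux h413 = `stmt-HodgeConjecture-24833`, route of record `HCCMUnconditional`; cell `hodgecm-mathlib`, squad K2, ENGINE E1 (campaign «EIS-R7-BL-SPH-3», the EXPORTS₃
print).  THEOREMS ONLY (no `def`, no `instance`, no `notation`, no named-fact hypothesis, no `sorry`; default heartbeats); lane `--supports stmt-HodgeConjecture-24833 --as helper`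
(count-neutral; closes no socket).
WHAT.  FILE X2₃ `…ExportsU3Global` (the `N = 3` print of K2E1-p13's X2) derives (E3)₃ — a whole-plane meromorphic `c̃`, analytic off the pole set, `= c(z) = ν(𝓕)⁻¹·∫_{N(𝔸)} H(ι(w₀)v)^z dν`
on `{2 < Re z}` — by gluing the per-ball coefficients `cc_n` of ★ X1₃ `exists_ball_package_cm_three` (p859610, at `φ₀ = 1`).  Two inputs are not in the tree in the needed currency:
* §1 **`cnstN_iota_toHX_eisensteinSeriesU_eq_cm_three`** — ★ S2₃ `exists_cnstN_iota_toHX_eisensteinSeriesU_eq_cm_three` (K2E1-p09, p859104) gives the constant-term equation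
  `cnst_N(ι[Ẽ_z]) = φ₀•[H^z] + b•[H^{2−z}]` in `𝓗_k(Z_a)` for SOME `b`; here the SAME statement with the EXPLICIT `b = φ₀·c(z)`, `c(z)` spelled as in ★ (Ξ₂)₃
  `K2E1SphericalEisensteinContinuationU3Final.borelConstantTerm_sphericalEisenstein_cm_three` (this seat, g6) — proof = ★ S2₃'s, with the pointwise constant term taken from ★ (Ξ₂)₃
  explicit instead of ★ `exists_borelConstantTerm_eisensteinSeriesU_eq_smul_add_smul_cm_three`.  With X1₃'s `α`-system `cnst_N(ι(vX z)) = φ₀•α₁ z + cc z•α₂ z`, its Godement agreement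
  `vX z = [E(φ₀H^z)]` and `α₂ z ≠ 0`, this pins `cc z = φ₀·c(z)` on `U ∩ {2 < Re z}`.
* §0 **`meromorphicOn_of_smul_eq_of_codiscrete`** (generic, any complete normed `ℂ`-space `V`): if `cc z • α z = R z` on a set `U` CO-DISCRETE in an open `D`, with `α` holomorphic and
  nowhere zero on `D` and `R` meromorphic on `D`, then `cc` is meromorphic on `D` (Hahn–Banach functional `ℓ` with `ℓ(α z₀) ≠ 0`, `cc = ℓ∘R ∕ ℓ∘α` on a punctured neighbourhood,
  `MeromorphicAt.congr`) — turns X1₃'s `DifferentiableOn ℂ cc U` + `α`-system into `MeromorphicOn cc (ball 0 (n+2))`, the input `hF` of ★ `exists_global_pole_set_of_lt 2` ∕ ★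
  `exists_meromorphicNFOn_univ_of_eventually_balls_of_lt` for (E3)₃ (rank-free; serves X2₂ too).
HONEST LABEL: HC_CM is proved only modulo the 7 printed citations (2 remaining named inputs: hLiu418 = `stmt-HodgeConjecture-24832`, h413 = `stmt-HodgeConjecture-24833`) until rung 0
closes; this file asserts no named fact, closes no socket; count-neutral.
[cite: BernsteinLapid2019, §4 (p. 10), §7] [cite: MoeglinWaldspurger1995, I.2.6, II.1.7] [cite: Garrett2018, §2.8]

## References
* [BernsteinLapid2019] J. Bernstein, E. Lapid, *On the meromorphic continuation of Eisenstein series*, J. AMS 37 (2024) (arXiv:1911.02342), §4 p. 10, §7.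
* [MoeglinWaldspurger1995] C. Mœglin, J.-L. Waldspurger, *Spectral decomposition and Eisenstein series* (1995), I.2.6, II.1.7.
* [Garrett2018] P. Garrett, *Modern Analysis of Automorphic Forms by Example* (2018), §2.8.
-/

set_option autoImplicit false
set_option linter.dupNamespace false  -- the mandated namespace repeats the summit's segment (`HodgeConjecture.HodgeConjecture`)

noncomputable section

open MeasureTheory Measure NumberField Set Filter Topology
open scoped ENNReal NNReal ComplexConjugate
open Literature.MeasureTheory.Group Literature.NumberTheory Literature.NumberTheory.Automorphic Literature.NumberTheory.Automorphic.UnitaryGroup AdelicGroupData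
open Summit.HodgeConjecture.HodgeConjecture.Cruxes.H413.K2E1BorelEisensteinU
open Summit.HodgeConjecture.HodgeConjecture.Cruxes.H413.K2E1BLBorelSpacesU2Defs
open Summit.HodgeConjecture.HodgeConjecture.Cruxes.H413.K2E1BLBorelOperatorsU2Defs
open Summit.HodgeConjecture.HodgeConjecture.Cruxes.H413.K2E1BLConstantTermProjectionMeasurableU2 (cnstN_toHN_eq_toHN_borelConstantTerm')
open Summit.HodgeConjecture.HodgeConjecture.Cruxes.H413.K2E1BorelEisensteinRegularCMThree (continuous_eisensteinSeriesU_flatSectionU_cm_three)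
open Summit.HodgeConjecture.HodgeConjecture.Cruxes.H413.K2E1SphericalEisensteinSolvesXSystemU2 (iota_toHX_eq_toHN memLp_zFun_of_iotaBound)
open Summit.HodgeConjecture.HodgeConjecture.Cruxes.H413.K2E1SphericalEisensteinSolvesXSystemU3 (eisensteinSeriesU_flatSectionU_quotientSubgroup_mul_three continuous_borelHeight_cpow_three)
open Summit.HodgeConjecture.HodgeConjecture.Cruxes.H413.K2E1SphericalEisensteinContinuationU3Final (borelConstantTerm_sphericalEisenstein_cm_three)

namespace Summit.HodgeConjecture.HodgeConjecture.Cruxes.H413.K2E1SphericalEisensteinConstantTermCoefficientCMThree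

/-! ## §0 The meromorphy device for the continued coefficient (generic) -/

/-- **MEROMORPHY OF A SCALAR COEFFICIENT FROM A VECTOR IDENTITY ON A CO-DISCRETE SET** (generic): `D` open, `U` co-discrete in `D` (`∀ z₀ ∈ D, ∀ᶠ s in 𝓝[≠] z₀, s ∈ U`), `α : ℂ → V`
holomorphic and nowhere zero on `D`, `R : ℂ → V` meromorphic on `D`, and `cc z • α z = R z` for `z ∈ U`; THEN `cc` is meromorphic on `D`: at `z₀ ∈ D` pick a continuous functional `ℓ`
with `ℓ(α z₀) = ‖α z₀‖ ≠ 0` (Hahn–Banach); `ℓ ∘ α` is analytic and non-zero near `z₀`, `ℓ ∘ R` is meromorphic at `z₀`, and `cc = (ℓ∘α)⁻¹·(ℓ∘R)` on a punctured neighbourhood of `z₀`.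
(The device that makes the continued constant-term coefficient `cc` of ★ X1 meromorphic on the whole ball from its `α`-system.) [folklore] [cite: BernsteinLapid2019, §4 p. 10] -/
theorem meromorphicOn_of_smul_eq_of_codiscrete {V : Type*} [NormedAddCommGroup V] [NormedSpace ℂ V] [CompleteSpace V] {D U : Set ℂ} (hD : IsOpen D)
    (hUcd : ∀ z₀ ∈ D, ∀ᶠ s in 𝓝[≠] z₀, s ∈ U) {cc : ℂ → ℂ} {α R : ℂ → V} (hα : DifferentiableOn ℂ α D) (hαne : ∀ z ∈ D, α z ≠ 0) (hR : MeromorphicOn R D)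
    (heq : ∀ z ∈ U, cc z • α z = R z) : MeromorphicOn cc D := by
  intro z₀ hz₀
  obtain ⟨ℓ, -, hℓ⟩ := exists_dual_vector ℂ (α z₀) (norm_ne_zero_iff.2 (hαne z₀ hz₀))
  have hℓ0 : ℓ (α z₀) ≠ 0 := by
    rw [hℓ]
    exact Complex.ofReal_ne_zero.2 (norm_ne_zero_iff.2 (hαne z₀ hz₀))
  have hℓα : AnalyticAt ℂ (fun s => ℓ (α s)) z₀ := (ℓ.analyticAt (α z₀)).comp (hα.analyticAt (hD.mem_nhds hz₀))
  have hℓR : MeromorphicAt (fun s => ℓ (R s)) z₀ := ℓ.comp_meromorphicAt (hR z₀ hz₀)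
  have hq : MeromorphicAt (fun s => (ℓ (α s))⁻¹ * ℓ (R s)) z₀ := hℓα.meromorphicAt.inv.mul hℓR
  refine hq.congr ?_
  have hne : ∀ᶠ s in 𝓝 z₀, ℓ (α s) ≠ 0 := hℓα.continuousAt.eventually_ne hℓ0
  filter_upwards [hUcd z₀ hz₀, mem_nhdsWithin_of_mem_nhds hne] with s hsU hs0
  have h1 := congrArg ℓ (heq s hsU)
  rw [map_smul, smul_eq_mul] at h1
  rw [← h1, mul_comm (cc s), ← mul_assoc, inv_mul_cancel₀ hs0, one_mul]

/-! ## §1 (S2)₃ with the explicit coefficient: `cnst_N (ι (toHX E_z)) = φ₀•[H^z] + (φ₀·c(z))•[H^{2−z}]` on `U(2,1)_{L/L⁺}` -/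

variable (L : Type) [Field L] [NumberField L] [IsCMField L]
variable [MeasurableSpace (quasiSplit (↥(maximalRealSubfield L)) L (IsCMField.complexConj L) 3).Adelic] [BorelSpace (quasiSplit (↥(maximalRealSubfield L)) L (IsCMField.complexConj L) 3).Adelic]

/-- **(S2)₃ WITH THE EXPLICIT `α₂`-COEFFICIENT.**  On `U(2,1)_{L/L⁺}`, for `2 < Re z`, any witness `hE : [Ẽ_z] ∈ 𝓗_k(𝔛)`, the pull-back `ι = iota hb` and the constant-term projection
`cnst_N = cnstN k a μZ`: `cnst_N (ι [Ẽ(φ₀H^z)]) = φ₀ • toHN (H^z) + (φ₀·c(z)) • toHN (H^{2−z})` with `c(z) = ν(𝓕)⁻¹·∫_{N(𝔸)} H(ι(w₀)v)^z dν` THE spherical constant-term scalar of ★ (Ξ₂)₃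
`borelConstantTerm_sphericalEisenstein_cm_three` — the statement of ★ S2₃ `exists_cnstN_iota_toHX_eisensteinSeriesU_eq_cm_three` with its `∃ b` made explicit (same letters `hdis'`,
`hα₁`, `hα₂`; same proof with the pointwise constant term from ★ (Ξ₂)₃ explicit). [cite: BernsteinLapid2019, §4 (p. 10), §7] [cite: MoeglinWaldspurger1995, I.2.6, II.1.7] [cite: Garrett2018, §2.8] -/
theorem cnstN_iota_toHX_eisensteinSeriesU_eq_cm_three
    (ν : Measure ↥(adelicUnipotent (↥(maximalRealSubfield L)) L (IsCMField.complexConj L) 3)) [ν.IsHaarMeasure] [ν.IsMulRightInvariant]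
    {𝓕 : Set ↥(adelicUnipotent (↥(maximalRealSubfield L)) L (IsCMField.complexConj L) 3)}
    (h𝓕N : IsFundamentalDomain ↥(rationalUnipotent (↥(maximalRealSubfield L)) L (IsCMField.complexConj L) 3) 𝓕 ν) (h𝓕c : IsCompact (closure 𝓕))
    {μ : Measure (quasiSplit (↥(maximalRealSubfield L)) L (IsCMField.complexConj L) 3).automorphicQuotient} {k : ℕ} {a : ℝ≥0} {μZ : Measure (borelQuotient (↥(maximalRealSubfield L)) L (IsCMField.complexConj L) 3)} [IsFiniteMeasure (weightedTruncMeasure (↥(maximalRealSubfield L)) L (IsCMField.complexConj L) 3 k a μZ)]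
    (hb : IotaBound (↥(maximalRealSubfield L)) L (IsCMField.complexConj L) 3 k a μ μZ)
    (hdis' : ∀ Φ : (quasiSplit (↥(maximalRealSubfield L)) L (IsCMField.complexConj L) 3).Adelic → ℂ, Measurable Φ → (∀ b ∈ ratBorelSubgroup (↥(maximalRealSubfield L)) L (IsCMField.complexConj L) 3, ∀ g, Φ (b * g) = Φ g) →
      Integrable (zFun (↥(maximalRealSubfield L)) L (IsCMField.complexConj L) 3 Φ) (weightedTruncMeasure (↥(maximalRealSubfield L)) L (IsCMField.complexConj L) 3 k a μZ) →
      Integrable (zFun (↥(maximalRealSubfield L)) L (IsCMField.complexConj L) 3 (borelConstantTerm ν 𝓕 Φ)) (weightedTruncMeasure (↥(maximalRealSubfield L)) L (IsCMField.complexConj L) 3 k a μZ) →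
        ∫ x, zFun (↥(maximalRealSubfield L)) L (IsCMField.complexConj L) 3 (borelConstantTerm ν 𝓕 Φ) x ∂(weightedTruncMeasure (↥(maximalRealSubfield L)) L (IsCMField.complexConj L) 3 k a μZ) = ∫ x, zFun (↥(maximalRealSubfield L)) L (IsCMField.complexConj L) 3 Φ x ∂(weightedTruncMeasure (↥(maximalRealSubfield L)) L (IsCMField.complexConj L) 3 k a μZ))
    (φ₀ : ℂ) {z : ℂ} (hz : 2 < z.re) (hE : MemLp ((quasiSplit (↥(maximalRealSubfield L)) L (IsCMField.complexConj L) 3).quotFun (eisensteinSeriesU (flatSectionU (fun _ : (quasiSplit (↥(maximalRealSubfield L)) L (IsCMField.complexConj L) 3).Adelic => φ₀) z))) 2 (μ.withDensity fun x => (((supHeight (↥(maximalRealSubfield L)) L (IsCMField.complexConj L) 3 x)⁻¹ ^ (2 * k) : ℝ≥0) : ℝ≥0∞)))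
    (hα₁ : MemLp (zFun (↥(maximalRealSubfield L)) L (IsCMField.complexConj L) 3 (fun g : (quasiSplit (↥(maximalRealSubfield L)) L (IsCMField.complexConj L) 3).Adelic => (((borelHeight g : ℝ)) : ℂ) ^ z)) 2 (weightedTruncMeasure (↥(maximalRealSubfield L)) L (IsCMField.complexConj L) 3 k a μZ))
    (hα₂ : MemLp (zFun (↥(maximalRealSubfield L)) L (IsCMField.complexConj L) 3 (fun g : (quasiSplit (↥(maximalRealSubfield L)) L (IsCMField.complexConj L) 3).Adelic => (((borelHeight g : ℝ)) : ℂ) ^ (2 - z))) 2 (weightedTruncMeasure (↥(maximalRealSubfield L)) L (IsCMField.complexConj L) 3 k a μZ)) :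
    cnstN (↥(maximalRealSubfield L)) L (IsCMField.complexConj L) 3 k a μZ (iota hb (toHX (↥(maximalRealSubfield L)) L (IsCMField.complexConj L) 3 k μ (eisensteinSeriesU (flatSectionU (fun _ : (quasiSplit (↥(maximalRealSubfield L)) L (IsCMField.complexConj L) 3).Adelic => φ₀) z)) hE)) =
      φ₀ • toHN (↥(maximalRealSubfield L)) L (IsCMField.complexConj L) 3 k a μZ (fun g : (quasiSplit (↥(maximalRealSubfield L)) L (IsCMField.complexConj L) 3).Adelic => (((borelHeight g : ℝ)) : ℂ) ^ z) hα₁ + (φ₀ * (((((ν 𝓕).toReal⁻¹ : ℝ)) : ℂ) * (∫ v : ↥(adelicUnipotent (↥(maximalRealSubfield L)) L (IsCMField.complexConj L) 3), (((borelHeight ((quasiSplit (↥(maximalRealSubfield L)) L (IsCMField.complexConj L) 3).toAdelic (weylLongU ((IsCMField.complexConj L : L ≃ₐ[↥(maximalRealSubfield L)] L) : L →+* L) (rfl : (StdForm.antidiagonal 3).over L = (StdForm.antidiagonal 3).over L)) * (v : (quasiSplit (↥(maximalRealSubfield L)) L (IsCMField.complexConj L) 3).Adelic))) : ℝ) : ℂ)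 ^ z ∂ν))) • toHN (↥(maximalRealSubfield L)) L (IsCMField.complexConj L) 3 k a μZ (fun g : (quasiSplit (↥(maximalRealSubfield L)) L (IsCMField.complexConj L) 3).Adelic => (((borelHeight g : ℝ)) : ℂ) ^ (2 - z)) hα₂ := by
  -- the pointwise constant term ★ (Ξ₂)₃, read as an identity of functions with the EXPLICIT coefficient `b = φ₀·c(z)`
  have hct : borelConstantTerm ν 𝓕 (eisensteinSeriesU (flatSectionU (fun _ : (quasiSplit (↥(maximalRealSubfield L)) L (IsCMField.complexConj L) 3).Adelic => φ₀) z)) =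
      φ₀ • (fun g : (quasiSplit (↥(maximalRealSubfield L)) L (IsCMField.complexConj L) 3).Adelic => (((borelHeight g : ℝ)) : ℂ) ^ z) + (φ₀ * (((((ν 𝓕).toReal⁻¹ : ℝ)) : ℂ) * (∫ v : ↥(adelicUnipotent (↥(maximalRealSubfield L)) L (IsCMField.complexConj L) 3), (((borelHeight ((quasiSplit (↥(maximalRealSubfield L)) L (IsCMField.complexConj L) 3).toAdelic (weylLongU ((IsCMField.complexConj L : L ≃ₐ[↥(maximalRealSubfield L)] L) : L →+* L) (rfl : (StdForm.antidiagonal 3).over L = (StdForm.antidiagonal 3).over L)) * (v : (quasiSplit (↥(maximalRealSubfield L)) L (IsCMField.complexConj L) 3).Adelic))) : ℝ) : ℂ) ^ z ∂ν))) • (fun g : (quasiSplit (↥(maximalRealSubfield L)) L (IsCMField.complexConj L) 3).Adelic => (((borelHeight g : ℝ)) : ℂ) ^ (2 - z)) := by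
    funext g
    rw [borelConstantTerm_sphericalEisenstein_cm_three L ν h𝓕N h𝓕c φ₀ hz g]
    simp only [Pi.add_apply, Pi.smul_apply, smul_eq_mul]
    ring
  -- verbatim ★ S2₃ from here on (invariances and measurability of `E_z`; the `Z`-lifts; ★ §1 compatibility, ★ P2b′, linearity of `toHN` read a.e.)
  have hφ := eisensteinSeriesU_flatSectionU_quotientSubgroup_mul_three L φ₀ z
  have hφB : ∀ γ ∈ ratBorelSubgroup (↥(maximalRealSubfield L)) L (IsCMField.complexConj L) 3, ∀ g : (quasiSplit (↥(maximalRealSubfield L)) L (IsCMField.complexConj L) 3).Adelic, (eisensteinSeriesU (flatSectionU (fun _ : (quasiSplit (↥(maximalRealSubfield L)) L (IsCMField.complexConj L) 3).Adelic => φ₀) z)) (γ * g) = (eisensteinSeriesU (flatSectionU (fun _ : (quasiSplit (↥(maximalRealSubfield L)) L (IsCMField.complexConj L) 3).Adelic => φ₀) z)) g := fun γ hγ g =>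
    hφ γ ((quasiSplit (↥(maximalRealSubfield L)) L (IsCMField.complexConj L) 3).arithmeticSubgroup_le_quotientSubgroup (ratBorelSubgroup_le_arithmeticSubgroup (↥(maximalRealSubfield L)) L (IsCMField.complexConj L) 3 hγ)) g
  have hφm : Measurable (eisensteinSeriesU (flatSectionU (fun _ : (quasiSplit (↥(maximalRealSubfield L)) L (IsCMField.complexConj L) 3).Adelic => φ₀) z)) := (continuous_eisensteinSeriesU_flatSectionU_cm_three L hz (φ := fun _ : (quasiSplit (↥(maximalRealSubfield L)) L (IsCMField.complexConj L) 3).Adelic => φ₀) continuous_const (M := ‖φ₀‖) fun _ => le_rfl).measurable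
  have hφZ : MemLp (zFun (↥(maximalRealSubfield L)) L (IsCMField.complexConj L) 3 (eisensteinSeriesU (flatSectionU (fun _ : (quasiSplit (↥(maximalRealSubfield L)) L (IsCMField.complexConj L) 3).Adelic => φ₀) z))) 2 (weightedTruncMeasure (↥(maximalRealSubfield L)) L (IsCMField.complexConj L) 3 k a μZ) := memLp_zFun_of_iotaBound hb hφ hE
  have hψ2 : MemLp (zFun (↥(maximalRealSubfield L)) L (IsCMField.complexConj L) 3 (borelConstantTerm ν 𝓕 (eisensteinSeriesU (flatSectionU (fun _ : (quasiSplit (↥(maximalRealSubfield L)) L (IsCMField.complexConj L) 3).Adelic => φ₀) z)))) 2 (weightedTruncMeasure (↥(maximalRealSubfield L)) L (IsCMField.complexConj L) 3 k a μZ) := by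
    rw [hct, zFun_add, zFun_smul, zFun_smul]
    exact (hα₁.const_smul φ₀).add (hα₂.const_smul _)
  have hψc : Continuous (borelConstantTerm ν 𝓕 (eisensteinSeriesU (flatSectionU (fun _ : (quasiSplit (↥(maximalRealSubfield L)) L (IsCMField.complexConj L) 3).Adelic => φ₀) z))) := by
    rw [hct]
    exact ((continuous_borelHeight_cpow_three L z).const_smul φ₀).add ((continuous_borelHeight_cpow_three L (2 - z)).const_smul _)
  rw [iota_toHX_eq_toHN hb hφ hE hφZ, cnstN_toHN_eq_toHN_borelConstantTerm' ν 𝓕 k a μZ h𝓕N hdis' hφm hφB hφZ hψ2 hψc]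
  refine Lp.ext ((coeFn_toHN (↥(maximalRealSubfield L)) L (IsCMField.complexConj L) 3 k a μZ _ hψ2).trans ?_)
  refine EventuallyEq.trans ?_ ((Lp.coeFn_add _ _).trans ((Lp.coeFn_smul _ _).add (Lp.coeFn_smul _ _))).symm
  filter_upwards [coeFn_toHN (↥(maximalRealSubfield L)) L (IsCMField.complexConj L) 3 k a μZ _ hα₁, coeFn_toHN (↥(maximalRealSubfield L)) L (IsCMField.complexConj L) 3 k a μZ _ hα₂] with x h₁ h₂
  rw [Pi.add_apply, Pi.smul_apply, Pi.smul_apply, h₁, h₂, hct, zFun_add, zFun_smul, zFun_smul]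
  rfl

end Summit.HodgeConjecture.HodgeConjecture.Cruxes.H413.K2E1SphericalEisensteinConstantTermCoefficientCMThree

end
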